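import Literature.NumberTheory.PAdicHodge.KummerFilZeroCoboundaryRamifiedOfWeil
import Literature.NumberTheory.EllipticCurves.TateModuleContinuityProofs
import Literature.NumberTheory.EllipticCurves.TateModuleBaseChange
import HarnessLib

/-!
# A `TatePtO`-valued cocycle, read through a Galois matching `e : T_pW₀ ≃ T_pŴ♭(𝒪_ℂ)`, is a continuous cocycle of `T_pW₀|_{Γ_F}`

Topic `Literature/NumberTheory/PAdicHodge`; THEOREMS ONLY (no definition, no named fact, no instance, no `sorry`). Half of gap 2a of memo
`Cruxes/StarredOptimalManinUnitFiveSeven/Lines/kato-lever-K3-legendre.md` §4/§6: the K1 programme's Kummer cocycle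
`κ_u = kummerCocycleO u : Γ_F → TatePtO` (cocycle law `kummerCocycleO_mul`) becomes, through the matching `e` of
`KummerFilZeroCoboundaryRamifiedOfWeil`, a CONTINUOUS cocycle `κ` of `restrictedTateRep W₀ F p` — the object the capstone
`TatePairingPointOfKTwoMatching` quantifies over — as soon as its level projections are locally constant (open stabilisers of the division
points). Continuity of `e⁻¹` is automatic: both Tate modules carry their `ℤ_p`-module topology (`TateModule.isModuleTopology`).

★ `exists_contOneCocycle_of_matching` — generic packaging (any `c : Γ_F → TatePtO` with the cocycle law and locally constant levels).
What remains of gap 2a: the level classes of `κ` are the Kummer classes `kummerLevelClass W₀ F p j P` of the point (model isomorphism on torsion).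

Crux K★ `stmt-BirchSwinnertonDyer-22226`; BSD / K★ are NOT proved by this file.

## References
* J.-P. Serre, *Abelian ℓ-adic representations* (1968), Ch. I §1.1–1.2. [Serre1968]
* J. H. Silverman, *AEC* (2009), VIII §2 (the Kummer pairing). [SilvermanAEC2009]
-/

noncomputable section

open Field Function ValuativeRel WittVector
open scoped Topology

namespace Literature.NumberTheory.PAdicHodge

open Literature.NumberTheory.GaloisRepresentations
open Literature.NumberTheory.GaloisRepresentations.IsNonarchimedeanLocalField
open Literature.NumberTheory.EllipticCurves
open _root_.WeierstrassCurve

variable {F : Type} [Field F] [ValuativeRel F] [TopologicalSpace F] [IsNonarchimedeanLocalField F] [CharZero F]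
  {p : ℕ} [Fact p.Prime] {hp : valuation F p < 1} {D : EisensteinRoot F p hp}
  (W : WeierstrassCurve (EisensteinRoot.CoeffDisc D)) (ψ : EisensteinRoot.CoeffDisc D →+* LTCoeff F)
  {K₀ : Type} [Field K₀] [Algebra K₀ F] (W₀ : WeierstrassCurve K₀) [W₀.IsElliptic]

/-- ★ **A `TatePtO`-valued cocycle read through a Galois matching is a continuous cocycle of `T_pW₀|_{Γ_F}`.** For a `ℤ_p`-linear
`Γ_F`-equivariant `e : T_pW₀ ≃ TatePtO` and `c : Γ_F → TatePtO` with `c(στ) = c(σ) + σ•c(τ)` whose level projections are locally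
constant, there is `κ ∈ Z¹_cont(Γ_F, T_pW₀)` with `κ(σ) = e⁻¹(c σ)`. [cite: Serre1968, Ch. I §1.1–1.2] [cite: SilvermanAEC2009, VIII §2] -/
theorem exists_contOneCocycle_of_matching (e : W₀.tateModule p ≃ₗ[ℤ_[p]] AinfTop.TatePtO F (W.map ψ) p)
    (he : ∀ (σ : absoluteGaloisGroup F) (a : W₀.tateModule p), e (absGaloisRestrict K₀ F σ • a) = σ • e a)
    (c : absoluteGaloisGroup F → AinfTop.TatePtO F (W.map ψ) p) (hc : ∀ σ τ, c (σ * τ) = c σ + σ • c τ)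
    (hlc : ∀ (n : ℕ) (σ₀ : absoluteGaloisGroup F), ∃ U : Set (absoluteGaloisGroup F), IsOpen U ∧ σ₀ ∈ U ∧
      ∀ σ ∈ U, TateModule.proj p n (c σ) = TateModule.proj p n (c σ₀)) :
    ∃ κ : contOneCocycles (restrictedTateRep W₀ F p).toTopRep, ∀ σ, κ.1 σ = e.symm (c σ) := by
  classical
  letI : TopologicalSpace ((W.map ψ).Pt (maxNilIdealC F)) := ⊥
  haveI : DiscreteTopology ((W.map ψ).Pt (maxNilIdealC F)) := ⟨rfl⟩
  haveI := module_finite_tateModule_holds W₀ p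
  haveI : Module.Finite ℤ_[p] (AinfTop.TatePtO F (W.map ψ) p) := Module.Finite.equiv e
  haveI := TateModule.isModuleTopology (A := (W.map ψ).Pt (maxNilIdealC F)) (p := p)
  haveI := TateModule.continuousSMul_padicInt (A := geomPoints W₀) (p := p)
  -- `c` is continuous (locally constant levels), `e⁻¹` is continuous (module topologies)
  have hcc : Continuous c := TateModule.continuous_of_proj fun n =>
    (IsLocallyConstant.iff_exists_open _).2 (fun σ₀ => hlc n σ₀) |>.continuous
  have hec : Continuous (e.symm : AinfTop.TatePtO F (W.map ψ) p → W₀.tateModule p) :=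
    IsModuleTopology.continuous_of_linearMap (e.symm : AinfTop.TatePtO F (W.map ψ) p →ₗ[ℤ_[p]] W₀.tateModule p)
  have hsymm : ∀ (σ : absoluteGaloisGroup F) (x : AinfTop.TatePtO F (W.map ψ) p),
      e.symm (σ • x) = absGaloisRestrict K₀ F σ • e.symm x := fun σ x => by
    apply e.injective; rw [he, LinearEquiv.apply_symm_apply, LinearEquiv.apply_symm_apply]
  refine ⟨⟨⟨fun σ => e.symm (c σ), hec.comp hcc⟩, fun g h => ?_⟩, fun σ => rfl⟩
  change e.symm (c (g * h)) = e.symm (c g) + restrictedTateRep W₀ F p g (e.symm (c h))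
  rw [hc, map_add, hsymm, restrictedTateRep_apply_apply]

end Literature.NumberTheory.PAdicHodge

end
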